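import Literature.AlgebraicGeometry.ProjectiveSpace.PointsHilbertFunctionGrowth
import Literature.AlgebraicGeometry.ProjectiveSpace.PointsLinearSpanHilbertFunction
import Literature.AlgebraicGeometry.ProjectiveSpace.IndependentConditionsUnlessCollinear
import HarnessLib

/-!
# Chasles's theorem (Cayley–Bacharach for plane cubics) and the collinearity criterion for
# `n ≤ 2d + 1` plane points (Eisenbud–Green–Harris 1996, Thm. CB3 and Prop. 1)

Topic `Literature/AlgebraicGeometry/ProjectiveSpace`, namespace
`Literature.AlgebraicGeometry.ProjectiveSpace`. Lane `lit-hodgefound`, seat `lit-hodgefound-p32`,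
row gen25-#9. Theorems only (no definition, no named fact).

## The source, as printed

D. Eisenbud, M. Green, J. Harris, *Cayley–Bacharach theorems and conjectures*, Bull. AMS 33 (1996),
§1.1. **Theorem CB3 (Chasles).** "Let `X_1, X_2 ⊂ ℙ²` be cubic plane curves meeting in nine points
`p_1, …, p_9`. If `X ⊂ ℙ²` is any cubic containing `p_1, …, p_8`, then `X` contains `p_9` as well."
(p. 299) "We shall prove it without making any assumptions about the smoothness or irreducibility of
`X_1` and `X_2` — that is, they can be the zero loci of any homogeneous cubic polynomials `F_1, F_2` on
`ℙ²`. … the hypotheses of Theorem CB3 rule out the possibility of `X_1` or `X_2` having multiple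
components". "With this language, Chasles's Theorem is equivalent to the following statement: If
`Γ = {p_1, …, p_9}` is the intersection of two plane cubics and `Γ' = {p_1, …, p_8}` is any subset
omitting one point, then `Γ` and `Γ'` impose the same number of conditions on cubics. We shall actually
prove the stronger statement that `Γ` and `Γ'` each impose exactly eight conditions on cubics".
**Proposition 1** (p. 300). "Let `Ω = {p_1, …, p_n} ⊂ ℙ²` be any collection of `n ≤ 2d + 2` distinct
points. The points of `Ω` fail to impose independent conditions on curves of degree `d` if and only if
either `d + 2` of the points of `Ω` are collinear or `n = 2d + 2` and `Ω` is contained in a conic." Proof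
of "if": "If `d + 2` of the points of `Ω` lie on a line `L`, then by Bézout's Theorem any curve of degree
`d` containing `Ω` must contain `L`. … the `d + 2` points of `Ω` impose at most `n − (d + 2)` [sic;
`d + 1`] conditions on curves of degree `d`, so we see that `Ω` imposes at most `n − 1` conditions."

## What is here (all `theorem`s)

* § 1 `hilbert_projVanishingIdeal_union_le` (`H_{Z ∪ Z'}(t) ≤ H_Z(t) + H_{Z'}(t)`, from
  `I(Z ∪ Z') = I(Z) ∩ I(Z')` and the lattice identity), `hilbert_projVanishingIdeal_le_image_add_card_compl`
  (`H_Z(t) ≤ H_{Z_s}(t) + #(ι ∖ s)`: a point imposes at most one condition).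
* § 2 **Proposition 1 for `n ≤ 2d + 1`**: `hilbert_projVanishingIdeal_lt_card_of_collinear` (the "if":
  `d + 2` collinear points impose `≤ d + 1` conditions, `PointsLinearSpanHilbertFunction`), and
  **`hilbert_projVanishingIdeal_lt_card_iff_exists_collinear`** (with the "only if" of
  `IndependentConditionsUnlessCollinear`, ACGH I.A Ex. 19). NOT here: the case `n = 2d + 2` (conics).
* § 3 **Theorem CB3 (Chasles)**, `chasles_cubic_through_eight_points` — for cubics `F, G` without
  common component (`[F, G]` a regular sequence) meeting in `9` distinct points, a cubic through `8` of
  them passes through the ninth (the `d = e = 3` case of `CayleyBacharachPointSets`' CB4 form); and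
  `hilbert_three_eq_eight_of_cubics`, `hilbert_three_image_compl_singleton_eq_eight_of_cubics`
  ("`Γ` and `Γ'` each impose exactly eight conditions on cubics").
* § 4 **Theorem CB4 (Cayley–Bacharach for plane curves)**, `cayleyBacharach_plane_curves` — plane curves
  of degrees `d, e` without common component meeting in `d·e` distinct points `Γ`: a curve of degree
  `d + e − 3` through all but one point of `Γ` contains `Γ` (EGH p. 302; the plane case of
  `CayleyBacharachPointSets.idealDegree_projVanishingIdeal_image_compl_singleton_eq`).

## References

* [EisenbudGreenHarris1996] D. Eisenbud, M. Green, J. Harris, *Cayley–Bacharach theorems and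
  conjectures*, Bull. Amer. Math. Soc. 33 (1996), §1.1: Thm. CB3 (p. 299), Prop. 1 (p. 300); §1.2:
  Thm. CB4 (p. 302).
* [ArbarelloEtAl1985] E. Arbarello, M. Cornalba, P. A. Griffiths, J. Harris, *Geometry of Algebraic
  Curves* I, Ch. I, Appendix A §1, Exercise 19 (p. 56).
-/

noncomputable section

open MvPolynomial Module RingTheory.Sequence
open Literature.RingTheory.MvPolynomial

universe u

namespace Literature.AlgebraicGeometry.ProjectiveSpace

variable {k : Type u} [Field k] {σ : Type*} [Fintype σ] {ι : Type*}

/-! ### § 1 A point imposes at most one condition -/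

/-- **`H_{Z ∪ Z'}(t) ≤ H_Z(t) + H_{Z'}(t)`** (`I(Z ∪ Z') = I(Z) ∩ I(Z')` and
`H(I ∩ J) + H(I + J) = H(I) + H(J)`). [cite: EisenbudGreenHarris1996, §1.1, proof of Prop. 1 (p. 300)] -/
theorem hilbert_projVanishingIdeal_union_le (Z Z' : Set (σ → k)) (t : ℕ) :
    finrank k (homogeneousSubmodule σ k t) - finrank k (idealDegree (projVanishingIdeal (Z ∪ Z')) t) ≤
      (finrank k (homogeneousSubmodule σ k t) - finrank k (idealDegree (projVanishingIdeal Z) t)) +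
        (finrank k (homogeneousSubmodule σ k t) - finrank k (idealDegree (projVanishingIdeal Z') t)) := by
  letI := MvPolynomial.gradedAlgebra (σ := σ) (R := k)
  have h := hilbert_inf_add_hilbert_sup (isHomogeneous_projVanishingIdeal Z)
    (isHomogeneous_projVanishingIdeal Z') t
  rw [← projVanishingIdeal_union] at h
  omega

/-- **A point imposes at most one condition**: `H_Z(t) ≤ H_{Z_s}(t) + #(ι ∖ s)` for the subset
`Z_s = {P_j}_{j ∈ s}` of `Z = {P_j}_{j ∈ ι}`. [cite: EisenbudGreenHarris1996, §1.1, proof of Prop. 1 (p. 300)] -/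
theorem hilbert_projVanishingIdeal_le_image_add_card_compl [Fintype ι] [DecidableEq ι] (P : ι → σ → k)
    (s : Finset ι) (t : ℕ) :
    finrank k (homogeneousSubmodule σ k t) - finrank k (idealDegree (projVanishingIdeal (Set.range P)) t) ≤
      (finrank k (homogeneousSubmodule σ k t) -
        finrank k (idealDegree (projVanishingIdeal (P '' (s : Set ι))) t)) + sᶜ.card := by
  have hunion : Set.range P = P '' (s : Set ι) ∪ P '' ((sᶜ : Finset ι) : Set ι) := by
    rw [← Set.image_union, Finset.coe_compl, Set.union_compl_self, Set.image_univ]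
  rw [hunion]
  exact (hilbert_projVanishingIdeal_union_le _ _ t).trans
    (Nat.add_le_add_left (hilbert_projVanishingIdeal_image_le_card P t sᶜ) _)

/-! ### § 2 Proposition 1 (the case `n ≤ 2d + 1`) -/

/-- **EGH Prop. 1, "if": `d + 2` collinear points among `Ω` make `Ω` fail to impose independent
conditions on curves of degree `d`** — the `d + 2` collinear points impose at most `d + 1` conditions
(`H ≤ d + 1` on a line), each further point at most one more, so `H_Ω(d) ≤ n − 1`.
[cite: EisenbudGreenHarris1996, §1.1, Prop. 1 (p. 300)] -/
theorem hilbert_projVanishingIdeal_lt_card_of_collinear [Fintype ι] (P : ι → σ → k) {d : ℕ}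
    (s : Finset ι) (hs : s.card = d + 2) (hcol : ∃ u v : σ → k, ∀ j ∈ s, P j ∈ Submodule.span k {u, v}) :
    finrank k (homogeneousSubmodule σ k d) - finrank k (idealDegree (projVanishingIdeal (Set.range P)) d) <
      Fintype.card ι := by
  classical
  obtain ⟨u, v, huv⟩ := hcol
  have hrange : Set.range (fun a : s => P a) = P '' (s : Set ι) := by
    ext x
    constructor
    · rintro ⟨a, rfl⟩
      exact ⟨a, a.2, rfl⟩
    · rintro ⟨i, hi, rfl⟩
      exact ⟨⟨i, hi⟩, rfl⟩
  have hline : finrank k (homogeneousSubmodule σ k d) -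
      finrank k (idealDegree (projVanishingIdeal (P '' (s : Set ι))) d) ≤ d + 1 := by
    rw [← hrange]
    exact hilbert_projVanishingIdeal_le_succ_of_mem_span_pair (fun a : s => P a) u v
      (fun a => huv a a.2) d
  have h := hilbert_projVanishingIdeal_le_image_add_card_compl P s d
  have hc : sᶜ.card = Fintype.card ι - s.card := Finset.card_compl s
  have hsle : s.card ≤ Fintype.card ι := Finset.card_le_univ s
  omega

/-- **EGH Prop. 1 for `n ≤ 2d + 1` distinct points: they fail to impose independent conditions on
curves of degree `d` if and only if `d + 2` of them are collinear** (the points are non-zero pairwise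
non-proportional vectors `P_j` of any `ℙ(k^σ)`; "collinear" = in the span of two vectors). The case
`n = 2d + 2` ("or `Ω` is contained in a conic") is NOT here. [cite: EisenbudGreenHarris1996, §1.1, Prop. 1 (p. 300)]
[cite: ArbarelloEtAl1985, Ch. I Appendix A §1, Exercise 19 (p. 56)] -/
theorem hilbert_projVanishingIdeal_lt_card_iff_exists_collinear [Fintype ι] (P : ι → σ → k)
    (h0 : ∀ i, P i ≠ 0) (hP : Pairwise fun i j => P i ∉ (k ∙ P j : Submodule k (σ → k))) {d : ℕ}
    (hcard : Fintype.card ι ≤ 2 * d + 1) :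
    finrank k (homogeneousSubmodule σ k d) - finrank k (idealDegree (projVanishingIdeal (Set.range P)) d) <
        Fintype.card ι ↔
      ∃ s : Finset ι, s.card = d + 2 ∧ ∃ u v : σ → k, ∀ j ∈ s, P j ∈ Submodule.span k {u, v} := by
  classical
  constructor
  · intro hlt
    by_contra hnot
    push Not at hnot
    have hcol : ∀ s : Finset ι, (∃ u v : σ → k, ∀ j ∈ s, P j ∈ Submodule.span k {u, v}) →
        s.card ≤ d + 1 := by
      rintro s ⟨u, v, huv⟩
      by_contra hgt
      obtain ⟨s', hs', hs'card⟩ := Finset.exists_subset_card_eq (s := s) (n := d + 2) (by omega)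
      obtain ⟨j, hj, hjn⟩ := hnot s' hs'card u v
      exact hjn (huv j (hs' hj))
    have h := hilbert_projVanishingIdeal_eq_card_of_collinear_card_le P h0 hP hcard hcol
    omega
  · rintro ⟨s, hs, hcol⟩
    exact hilbert_projVanishingIdeal_lt_card_of_collinear P s hs hcol

/-! ### § 3 Chasles's theorem -/

/-- **Theorem CB3 (Chasles): two plane cubics `F = 0`, `G = 0` without common component (`[F, G]` a
regular sequence) meeting in nine distinct points `p_1, …, p_9`; then any cubic `X` containing eight of
the points contains the ninth** — the case `d = e = 3`, `s = d + e − 3 = 3` of Theorem CB4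
(`CayleyBacharachPointSets.idealDegree_projVanishingIdeal_image_compl_singleton_eq`: `I(Γ ∖ {p_i})_3 =
I(Γ)_3`); `k` infinite. [cite: EisenbudGreenHarris1996, §1.1, Thm. CB3 (p. 299)] -/
theorem chasles_cubic_through_eight_points [Infinite k] [Fintype ι] [DecidableEq ι]
    (F G : MvPolynomial (Fin 3) k) (hF : F.IsHomogeneous 3) (hG : G.IsHomogeneous 3)
    (hreg : IsWeaklyRegular (MvPolynomial (Fin 3) k) [F, G]) (p : ι → Fin 3 → k) (h0 : ∀ i, p i ≠ 0)
    (hp : Pairwise fun i j => p i ∉ (k ∙ p j : Submodule k (Fin 3 → k)))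
    (hZF : ∀ i, MvPolynomial.eval (p i) F = 0) (hZG : ∀ i, MvPolynomial.eval (p i) G = 0)
    (hcard : Fintype.card ι = 9) (i : ι) {X : MvPolynomial (Fin 3) k} (hX : X.IsHomogeneous 3)
    (hXj : ∀ j, j ≠ i → MvPolynomial.eval (p j) X = 0) : MvPolynomial.eval (p i) X = 0 := by
  have hCB4 := idealDegree_projVanishingIdeal_image_compl_singleton_eq (r := 2) (by norm_num) ![F, G]
    ![3, 3] (fun m => ?_) (fun m => ?_) (by simpa using hreg) p h0 hp (fun j m => ?_)
    (by rw [hcard, Fin.prod_univ_two]; rfl) i (s := 3) (by rw [Fin.sum_univ_two]; rfl)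
  · have hXmem : X ∈ idealDegree (projVanishingIdeal (p '' ({i}ᶜ : Set ι))) 3 := by
      refine mem_idealDegree.mpr ⟨(mem_projVanishingIdeal_iff_of_isHomogeneous hX).mpr ?_, hX⟩
      rintro _ ⟨j, hj, rfl⟩
      exact hXj j hj
    rw [hCB4] at hXmem
    exact (mem_projVanishingIdeal_iff_of_isHomogeneous hX).mp (mem_idealDegree.mp hXmem).1 (p i)
      (Set.mem_range_self i)
  · fin_cases m
    · exact hF
    · exact hG
  · fin_cases m
    · norm_num
    · norm_num
  · fin_cases m
    · exact hZF j
    · exact hZG j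

/-- **"`Γ` imposes exactly eight conditions on cubics"**: for the nine points of two cubics as above,
`H_Γ(3) = 8` (CB5 with `k = 3`, `a = 0`, `Γ' = ∅`: `H_Γ(3) + H_Γ(0) = 9`).
[cite: EisenbudGreenHarris1996, §1.1, proof of Thm. CB3 (p. 299)] -/
theorem hilbert_three_eq_eight_of_cubics [Infinite k] [Fintype ι] [DecidableEq ι]
    (F G : MvPolynomial (Fin 3) k) (hF : F.IsHomogeneous 3) (hG : G.IsHomogeneous 3)
    (hreg : IsWeaklyRegular (MvPolynomial (Fin 3) k) [F, G]) (p : ι → Fin 3 → k) (h0 : ∀ i, p i ≠ 0)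
    (hp : Pairwise fun i j => p i ∉ (k ∙ p j : Submodule k (Fin 3 → k)))
    (hZF : ∀ i, MvPolynomial.eval (p i) F = 0) (hZG : ∀ i, MvPolynomial.eval (p i) G = 0)
    (hcard : Fintype.card ι = 9) :
    finrank k (homogeneousSubmodule (Fin 3) k 3) -
      finrank k (idealDegree (projVanishingIdeal (Set.range p)) 3) = 8 := by
  have hι : Nonempty ι := Fintype.card_pos_iff.mp (by omega)
  have h := hilbert_add_hilbert_eq_of_planeCurves F G hF hG (by norm_num) (by norm_num) hreg p h0 hp
    hZF hZG hcard ∅ (kk := 3) (a := 0) (by norm_num)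
  rw [Finset.coe_empty, Set.compl_empty, Set.image_univ, Set.image_empty, projVanishingIdeal_empty,
    idealDegree_top, Nat.sub_self, zero_add, Finset.compl_empty, Finset.card_univ, hcard,
    hilbert_projVanishingIdeal_zero (Set.range_nonempty p)] at h
  omega

/-- **"`Γ'` imposes exactly eight conditions on cubics"**: any eight of the nine points impose
independent conditions on cubics, `H_{Γ ∖ {p_i}}(3) = 8` (CB5 with `Γ' = Γ ∖ {p_i}`, `Γ'' = {p_i}`).
[cite: EisenbudGreenHarris1996, §1.1, proof of Thm. CB3 (p. 299)] -/
theorem hilbert_three_image_compl_singleton_eq_eight_of_cubics [Infinite k] [Fintype ι] [DecidableEq ι]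
    (F G : MvPolynomial (Fin 3) k) (hF : F.IsHomogeneous 3) (hG : G.IsHomogeneous 3)
    (hreg : IsWeaklyRegular (MvPolynomial (Fin 3) k) [F, G]) (p : ι → Fin 3 → k) (h0 : ∀ i, p i ≠ 0)
    (hp : Pairwise fun i j => p i ∉ (k ∙ p j : Submodule k (Fin 3 → k)))
    (hZF : ∀ i, MvPolynomial.eval (p i) F = 0) (hZG : ∀ i, MvPolynomial.eval (p i) G = 0)
    (hcard : Fintype.card ι = 9) (i : ι) :
    finrank k (homogeneousSubmodule (Fin 3) k 3) -
      finrank k (idealDegree (projVanishingIdeal (p '' ({i}ᶜ : Set ι))) 3) = 8 := by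
  have h9 := hilbert_three_eq_eight_of_cubics F G hF hG hreg p h0 hp hZF hZG hcard
  have h := hilbert_add_hilbert_eq_of_planeCurves F G hF hG (by norm_num) (by norm_num) hreg p h0 hp
    hZF hZG hcard ({i}ᶜ : Finset ι) (kk := 3) (a := 0) (by norm_num)
  rw [compl_compl, Finset.card_singleton, Finset.coe_compl, compl_compl, Finset.coe_singleton,
    Set.image_singleton, hilbert_projVanishingIdeal_singleton (h0 i) 0, h9] at h
  omega

/-! ### § 4 Theorem CB4: Cayley–Bacharach for two plane curves -/

/-- **Theorem CB4 (Cayley–Bacharach).** "Let `X_1, X_2 ⊂ ℙ²` be plane curves of degrees `d` and `e`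
respectively, meeting in a collection of `d · e` distinct points `Γ = {p_1, …, p_{de}}`. If `C ⊂ ℙ²` is
any plane curve of degree `d + e − 3` containing all but one point of `Γ`, then `C` contains all of
`Γ`." Here `X_1 = {F = 0}`, `X_2 = {G = 0}` with `[F, G]` a regular sequence (no common component), the
`p_j` non-zero pairwise non-proportional common zeros, `#ι = d·e`, `s + 3 = d + e`; `k` infinite. The
plane case of `CayleyBacharachPointSets.idealDegree_projVanishingIdeal_image_compl_singleton_eq`
(`I(Γ ∖ {p_i})_s = I(Γ)_s`). [cite: EisenbudGreenHarris1996, §1.2, Thm. CB4 (p. 302)] -/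
theorem cayleyBacharach_plane_curves [Infinite k] [Fintype ι] [DecidableEq ι]
    (F G : MvPolynomial (Fin 3) k) {d e : ℕ} (hF : F.IsHomogeneous d) (hG : G.IsHomogeneous e)
    (hd : 0 < d) (he : 0 < e) (hreg : IsWeaklyRegular (MvPolynomial (Fin 3) k) [F, G])
    (p : ι → Fin 3 → k) (h0 : ∀ i, p i ≠ 0)
    (hp : Pairwise fun i j => p i ∉ (k ∙ p j : Submodule k (Fin 3 → k)))
    (hZF : ∀ i, MvPolynomial.eval (p i) F = 0) (hZG : ∀ i, MvPolynomial.eval (p i) G = 0)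
    (hcard : Fintype.card ι = d * e) {s : ℕ} (hs : s + 3 = d + e) (i : ι) {C : MvPolynomial (Fin 3) k}
    (hC : C.IsHomogeneous s) (hCj : ∀ j, j ≠ i → MvPolynomial.eval (p j) C = 0) :
    MvPolynomial.eval (p i) C = 0 := by
  have hCB4 := idealDegree_projVanishingIdeal_image_compl_singleton_eq (r := 2) (by norm_num) ![F, G]
    ![d, e] (fun m => ?_) (fun m => ?_) (by simpa using hreg) p h0 hp (fun j m => ?_)
    (by rw [hcard, Fin.prod_univ_two]; rfl) i (s := s) (by rw [Fin.sum_univ_two]; exact hs)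
  · have hCmem : C ∈ idealDegree (projVanishingIdeal (p '' ({i}ᶜ : Set ι))) s := by
      refine mem_idealDegree.mpr ⟨(mem_projVanishingIdeal_iff_of_isHomogeneous hC).mpr ?_, hC⟩
      rintro _ ⟨j, hj, rfl⟩
      exact hCj j hj
    rw [hCB4] at hCmem
    exact (mem_projVanishingIdeal_iff_of_isHomogeneous hC).mp (mem_idealDegree.mp hCmem).1 (p i)
      (Set.mem_range_self i)
  · fin_cases m
    · exact hF
    · exact hG
  · fin_cases m
    · exact hd
    · exact he
  · fin_cases m
    · exact hZF j
    · exact hZG j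

end Literature.AlgebraicGeometry.ProjectiveSpace

end
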